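import Literature.Probability.Percolation.ConditionalPositiveAssociationProofs
import HarnessLib

/-!
# SITE percolation given `{s ↮ X}` — I: restriction to a vertex set and conditioning on the states of `Z`

Part I of three (`SiteVdBHKRestrict` → `SiteVdBHKCore` → `SiteVdBHK`): the restricted site cluster `sC`, the
events `sD`, the random neighbour set `sS`, the site form of BHK's identity (6) and its summed form `step_sum`.


builds on p205010 (kernel theorem, internal audit signed; external expert review pending).

van den Berg–Häggström–Kahn (Random Structures Algorithms 29 (2006), Thms 1.1–1.3) prove, for
BOND percolation, that the open cluster `C_s` is positively associated conditionally on
`R_X = {s ↮ X}`; the tree proves it in `ConditionalPositiveAssociationProofs.lean`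
(`BHK2006.core`, `BHK2006_clusterConditionalPositiveAssociation_holds`).  The printed theorem does
NOT cover site percolation ("Consider ordinary bond percolation", §1 p. 3), and site percolation is
not a special case of bond percolation; the p205010 chain uses Thm 1.3 at its links (B0) and (C2)
(CHAIN-READ §3.7, §4.4), so a site re-run of the chain needs the SITE theorem.  This file proves it
(OUR theorem; the census seat's sketch `run/shared/lean/prim/bschramm/CENSUS.md` §7b):

**Setting (convention A).** `V` finite, `Γ : SimpleGraph V`, vertex weights `q : V → [0,1]`, law
`prodBernoulli q` on `Set V` (the open vertices); `u ↔ v` iff `u, v` are open and joined by a path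
of open vertices; `C_s = siteCluster Γ ω s` (`= ∅` if `s` is closed); `R_X = {∀ x ∈ X, x ∉ C_s}`
(so `s ∈ X` is allowed and then `R_X = {s closed}`).

* `SiteBHK.core` — **site Thm 1.1, functional form**, for percolation restricted to a vertex set
  `U`: for `F, G ≥ 0` increasing,
  `E[F(C) 1_{R_X}] E[G(C) 1_{R_Y}] ≤ E[F(C) G(C) 1_{R_{X∩Y}}] P(R_{X∪Y})`.
  PROOF = BHK's induction on the vertex set with ONE substitution: instead of conditioning on the
  set of vertices joined to `Z = X ∩ Y` by an open EDGE, condition on the STATES OF THE VERTICES OF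
  `Z` (a block of coordinates of `ω : Set V`, product law — `BHK2006.blockFubini`); given them, with
  `S` = the open vertices of `Z` and `N(S)` = their neighbours in `U ∖ Z`,
  `{s ↮ W in U} = {s ↮ (W ∖ Z) ∪ N(S) in U ∖ Z}` for `W ⊇ Z` and on this event the cluster of `s`
  in `U` is its cluster in `U ∖ Z` (`SiteBHK.mem_sD_iff_restrict`, `SiteBHK.sC_restrict`: a path
  from `s` first enters `Z` at an OPEN vertex, from a neighbour reached inside `U ∖ Z`; closed
  vertices of `Z` block).  `N(S ∩ T) ⊆ N(S) ∩ N(T)`, `N(S ∪ T) = N(S) ∪ N(T)`, and the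
  Ahlswede–Daykin step is verbatim (`four_functions_theorem_univ` with the product-weight lattice
  identity × the induction hypothesis).  `Z = ∅` is Harris twice; the degenerate placements
  `s ∈ X` / `s ∈ Y` (where `R = {s closed}` and `C = ∅`) hold pointwise.
* `SiteBHK.siteClusterCondPosAssoc` — **site Thm 1.3**: for `F, G` monotone functions of the site
  cluster, `(∫_{R_X} F(C_s))(∫_{R_X} G(C_s)) ≤ P(R_X) ∫_{R_X} F(C_s) G(C_s)` under `prodBernoulli q`
  (denominator-free, exactly the shape of the bond fact `BHK2006_clusterConditionalPositiveAssociation`,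
  with NO hypothesis `s ∉ X`).

Exact census (census seat, CENSUS.md §4, rows BHK13/VDBK*): 0 violations on n ≤ 5 exhaustive
(9.8 M instances) before this proof was written.  Support file (`--supports stmt-CriticalPhenomena-4575
--as helper`); sorry-free, standard axioms; no new `Prop` definitions.
[cite: VandenbergHaggstromKahn2005, Thms. 1.1–1.3 (pp. 3–6)] [cite: GrimmettPercolation1999, §1.6 p. 24]
-/

noncomputable section

namespace Summit.CriticalPhenomena.PercolationContinuityZ3.Theorems.Transplant

namespace SiteBHK

open MeasureTheory unitInterval
open Literature.Probability.LatticeModels (prodBernoulli)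
open Literature.Probability.Percolation
open Literature.Probability.Percolation.BHK2006 (weight weight_nonneg weight_inter_mul_union blockFubini
  sum_affine harris harris_mono_anti harris_anti_anti sum_ind_mono sum_ind_nonneg
  integral_prodBernoulli_eq_sum ind_le_one ind_mono ind_inter)
open scoped Classical
open DecisionTree (ind ind_of_mem ind_of_not_mem ind_nonneg)

variable {V : Type*} (Γ : SimpleGraph V)

/-! ### Site percolation restricted to a vertex set `U` -/

/-- The open SITE cluster of `s` computed inside the vertex set `U`: the vertices `y ∈ U` joined to
`s` by a `Γ`-path of open vertices of `U`, provided `s` itself is open and in `U` (else `∅`).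
(Site analogue of `BHK2006.rC`.) [cite: VandenbergHaggstromKahn2005, §1 p. 3 (`C_s`), p. 4 (`G − Z`)] -/
def sC (U : Finset V) (s : V) (ω : Set V) : Set V :=
  {y | s ∈ ω ∩ ↑U ∧ y ∈ ω ∩ ↑U ∧ (siteOpenGraph Γ (ω ∩ ↑U)).Reachable s y}

/-- The SITE event `R_X = {s ↮ X}` inside `U`: no vertex of `X` lies in the cluster of `s`
(for `s ∈ X ∩ U` this says `s` is closed). (Site analogue of `BHK2006.rD`.)
[cite: VandenbergHaggstromKahn2005, §1 p. 3 (`R_X`)] -/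
def sD (U : Finset V) (s : V) (X : Set V) : Set (Set V) :=
  {ω | ∀ x ∈ X, x ∉ sC Γ U s ω}

/-- The random set of the site induction: the vertices of `U ∖ Z` having an OPEN neighbour in `Z`
(it depends on the states of the vertices of `Z` only). (Site replacement of BHK's `S`, p. 4.)
[cite: VandenbergHaggstromKahn2005, §1 p. 4 (`S`)] -/
def sS (U Z : Finset V) (ω : Set V) : Set V :=
  {n | n ∈ U \ Z ∧ ∃ z ∈ Z, z ∈ ω ∧ Γ.Adj n z}

variable {Γ}

/-- Adjacency in the site-open graph of `ω ∩ U`. [folklore] -/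
theorem adj_iff {U : Finset V} {ω : Set V} {x y : V} :
    (siteOpenGraph Γ (ω ∩ ↑U)).Adj x y ↔ Γ.Adj x y ∧ (x ∈ ω ∧ x ∈ U) ∧ (y ∈ ω ∧ y ∈ U) := by
  rw [siteOpenGraph_adj]
  simp only [Set.mem_inter_iff, Finset.mem_coe]

/-- More open sites give a larger site-open graph. [folklore] -/
theorem siteOpenGraph_mono {ω ω' : Set V} (h : ω ⊆ ω') : siteOpenGraph Γ ω ≤ siteOpenGraph Γ ω' := by
  intro x y hxy
  rw [siteOpenGraph_adj] at hxy ⊢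
  exact ⟨hxy.1, h hxy.2.1, h hxy.2.2⟩

/-- The restricted site cluster is increasing in the configuration. [cite: VandenbergHaggstromKahn2005, §1 p. 3] -/
theorem sC_mono (U : Finset V) (s : V) : Monotone (sC Γ U s) := by
  intro ω ω' h y hy
  obtain ⟨hs, hy', hr⟩ := hy
  exact ⟨⟨h hs.1, hs.2⟩, ⟨h hy'.1, hy'.2⟩,
    hr.mono (siteOpenGraph_mono (Set.inter_subset_inter_left _ h))⟩

/-- The restricted site cluster is increasing in the vertex set `U`. [folklore] -/
theorem sC_mono_set {U U' : Finset V} (h : U' ⊆ U) (s : V) (ω : Set V) : sC Γ U' s ω ⊆ sC Γ U s ω := by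
  intro y hy
  obtain ⟨hs, hy', hr⟩ := hy
  have hsub : ω ∩ ↑U' ⊆ ω ∩ ↑U := Set.inter_subset_inter_right _ (Finset.coe_subset.2 h)
  exact ⟨hsub hs, hsub hy', hr.mono (siteOpenGraph_mono hsub)⟩

/-- The restricted cluster only depends on the states of the vertices of `U`. [folklore] -/
theorem sC_inter (U : Finset V) (s : V) (ω : Set V) (A : Set V) (hA : (↑U : Set V) ⊆ A) :
    sC Γ U s (ω ∩ A) = sC Γ U s ω := by
  have : ω ∩ A ∩ ↑U = ω ∩ ↑U := by
    ext v; constructor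
    · rintro ⟨⟨h1, -⟩, h2⟩; exact ⟨h1, h2⟩
    · rintro ⟨h1, h2⟩; exact ⟨⟨h1, hA h2⟩, h2⟩
  simp only [sC, this]

/-- `R_X` is a decreasing event. [cite: VandenbergHaggstromKahn2005, §1 p. 3] -/
theorem sD_decreasing {U : Finset V} {s : V} {X : Set V} {ω ω' : Set V} (h : ω ⊆ ω')
    (h' : ω' ∈ sD Γ U s X) : ω ∈ sD Γ U s X := fun x hx hr => h' x hx (sC_mono U s h hr)

/-- The indicator of `R_X` is antitone. [cite: VandenbergHaggstromKahn2005, §1 p. 3] -/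
theorem ind_sD_antitone (U : Finset V) (s : V) (X : Set V) : Antitone (ind (sD Γ U s X)) := by
  intro ω ω' h
  by_cases h' : ω' ∈ sD Γ U s X
  · rw [ind_of_mem h', ind_of_mem (sD_decreasing h h')]
  · rw [ind_of_not_mem h']; exact ind_nonneg _ _

/-- `R_X` is antitone in `X`. [cite: VandenbergHaggstromKahn2005, §1 p. 3] -/
theorem sD_antitone {U : Finset V} {s : V} {X X' : Set V} (h : X ⊆ X') : sD Γ U s X' ⊆ sD Γ U s X :=
  fun _ hω x hx => hω x (h hx)

/-- `R_{X ∪ Y} = R_X ∩ R_Y`. [cite: VandenbergHaggstromKahn2005, §1 p. 4] -/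
theorem sD_union (U : Finset V) (s : V) (X Y : Set V) :
    sD Γ U s (X ∪ Y) = sD Γ U s X ∩ sD Γ U s Y := by
  ext ω
  simp only [sD, Set.mem_setOf_eq, Set.mem_inter_iff, Set.mem_union, or_imp, forall_and]

/-- `R_T` inside `U` only depends on the states of the vertices of `U`. [folklore] -/
theorem mem_sD_inter (U : Finset V) (s : V) (T : Set V) (ω : Set V) (A : Set V)
    (hA : (↑U : Set V) ⊆ A) : ω ∩ A ∈ sD Γ U s T ↔ ω ∈ sD Γ U s T := by
  simp only [sD, Set.mem_setOf_eq, sC_inter U s ω A hA]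

/-- When `s ∈ X ∩ U`, `R_X` is the event "`s` is closed". [folklore] -/
theorem mem_sD_iff_notMem {U : Finset V} {s : V} (hsU : s ∈ U) {X : Set V} (hsX : s ∈ X)
    (ω : Set V) : ω ∈ sD Γ U s X ↔ s ∉ ω := by
  constructor
  · intro h hs
    exact h s hsX ⟨⟨hs, hsU⟩, ⟨hs, hsU⟩, SimpleGraph.Reachable.refl s⟩
  · intro hs x _ hx
    exact hs hx.1.1

/-- When `s` is closed its cluster is empty. [folklore] -/
theorem sC_eq_empty_of_notMem {U : Finset V} {s : V} {ω : Set V} (hs : s ∉ ω) : sC Γ U s ω = ∅ :=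
  Set.eq_empty_of_forall_notMem fun _ hy => hs hy.1.1

/-- `S ⊆ U ∖ Z`. [cite: VandenbergHaggstromKahn2005, §1 p. 4] -/
theorem sS_subset (U Z : Finset V) (ω : Set V) : sS Γ U Z ω ⊆ ↑(U \ Z) := fun _ hn => hn.1

/-- `S(a ∩ b) ⊆ S(a) ∩ S(b)`. [folklore] -/
theorem sS_inter_subset (U Z : Finset V) (a b : Set V) :
    sS Γ U Z (a ∩ b) ⊆ sS Γ U Z a ∩ sS Γ U Z b := fun _ ⟨hn, z, hz, hzo, hadj⟩ =>
  ⟨⟨hn, z, hz, hzo.1, hadj⟩, ⟨hn, z, hz, hzo.2, hadj⟩⟩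

/-- `S(a ∪ b) = S(a) ∪ S(b)`. [folklore] -/
theorem sS_union (U Z : Finset V) (a b : Set V) : sS Γ U Z (a ∪ b) = sS Γ U Z a ∪ sS Γ U Z b := by
  ext n
  constructor
  · rintro ⟨hn, z, hz, h | h, hadj⟩
    · exact Or.inl ⟨hn, z, hz, h, hadj⟩
    · exact Or.inr ⟨hn, z, hz, h, hadj⟩
  · rintro (⟨hn, z, hz, h, hadj⟩ | ⟨hn, z, hz, h, hadj⟩)
    · exact ⟨hn, z, hz, Or.inl h, hadj⟩
    · exact ⟨hn, z, hz, Or.inr h, hadj⟩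

/-- `S` only depends on the states of the vertices of `Z`. [folklore] -/
theorem sS_inter (U Z : Finset V) (ω : Set V) : sS Γ U Z (ω ∩ ↑Z) = sS Γ U Z ω := by
  ext n
  constructor
  · rintro ⟨hn, z, hz, h, hadj⟩
    exact ⟨hn, z, hz, h.1, hadj⟩
  · rintro ⟨hn, z, hz, h, hadj⟩
    exact ⟨hn, z, hz, ⟨h, hz⟩, hadj⟩

/-- `(ω ∖ Z) ∩ (U ∖ Z) = ω ∩ (U ∖ Z)`: the configuration off `Z` inside `U ∖ Z`. [folklore] -/
theorem diff_inter_coe_sdiff (U Z : Finset V) (ω : Set V) :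
    (ω \ ↑Z) ∩ (↑(U \ Z) : Set V) = ω ∩ ↑(U \ Z) := by
  ext v
  simp only [Set.mem_inter_iff, Set.mem_sdiff, Finset.coe_sdiff]
  tauto

/-- The cluster inside `U ∖ Z` does not depend on the states on `Z`. [folklore] -/
theorem sC_diff (U Z : Finset V) (s : V) (ω : Set V) : sC Γ (U \ Z) s (ω \ ↑Z) = sC Γ (U \ Z) s ω := by
  simp only [sC, diff_inter_coe_sdiff]

/-- The events `R_T` inside `U ∖ Z` do not depend on the states on `Z`. [folklore] -/
theorem mem_sD_diff (U Z : Finset V) (s : V) (T : Set V) (ω : Set V) :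
    ω \ ↑Z ∈ sD Γ (U \ Z) s T ↔ ω ∈ sD Γ (U \ Z) s T := by
  simp only [sD, Set.mem_setOf_eq, sC_diff]

/-- **The site form of BHK's identity (6), pointwise engine**: if inside `U ∖ Z` the open vertex `s ∉ Z`
is joined to no vertex having an OPEN neighbour in `Z`, then every vertex of the cluster of `s` in
`U` lies outside `Z` and in the cluster of `s` in `U ∖ Z` (a path from `s` that meets `Z` meets it
first at an open vertex, from a neighbour reached inside `U ∖ Z`).
[cite: VandenbergHaggstromKahn2005, §1 p. 4, identity (6)] -/
theorem reach_restrict {U Z : Finset V} {s : V} (hs : s ∉ Z) {ω : Set V}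
    (hS : ∀ n ∈ sS Γ U Z ω, n ∉ sC Γ (U \ Z) s ω) {v : V} (hv : v ∈ sC Γ U s ω) :
    v ∉ Z ∧ v ∈ sC Γ (U \ Z) s ω := by
  obtain ⟨⟨hso, hsU⟩, -, hr⟩ := hv
  have hsU : s ∈ U := hsU
  have hs' : s ∈ ω ∩ (↑(U \ Z) : Set V) := ⟨hso, by simpa using And.intro hsU hs⟩
  rw [SimpleGraph.reachable_iff_reflTransGen] at hr
  induction hr with
  | refl => exact ⟨hs, hs', hs', SimpleGraph.Reachable.refl s⟩
  | tail _ hbc ih =>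
    obtain ⟨hbZ, hb⟩ := ih
    obtain ⟨hadj, ⟨hbo, hbU⟩, ⟨hco, hcU⟩⟩ := adj_iff.1 hbc
    have hbU : _ ∈ U := hbU
    have hcU : _ ∈ U := hcU
    have hcZ : _ ∉ Z := fun hcZ =>
      hS _ ⟨Finset.mem_sdiff.2 ⟨hbU, hbZ⟩, _, hcZ, hco, hadj⟩ hb
    refine ⟨hcZ, hb.1, ⟨hco, by simpa using And.intro hcU hcZ⟩, hb.2.2.trans (SimpleGraph.Adj.reachable ?_)⟩
    exact adj_iff.2 ⟨hadj, ⟨hbo, Finset.mem_sdiff.2 ⟨hbU, hbZ⟩⟩, ⟨hco, Finset.mem_sdiff.2 ⟨hcU, hcZ⟩⟩⟩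

/-- **Site (6)**, pointwise: for `Z ⊆ U`, `Z ⊆ W` and `s ∉ Z`, `{s ↮ W in U}` is the event
`{s ↮ (W ∖ Z) ∪ S(ω) in U ∖ Z}`, `S(ω)` = the vertices of `U ∖ Z` with an open neighbour in `Z`.
[cite: VandenbergHaggstromKahn2005, §1 p. 4, identity (6)] -/
theorem mem_sD_iff_restrict {U Z : Finset V} (hZU : Z ⊆ U) {s : V} (hs : s ∉ Z) {W : Set V}
    (hZW : (↑Z : Set V) ⊆ W) (ω : Set V) :
    ω ∈ sD Γ U s W ↔ ω ∈ sD Γ (U \ Z) s ((W \ ↑Z) ∪ sS Γ U Z ω) := by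
  constructor
  · intro h x hx hreach
    have hxU : x ∈ sC Γ U s ω := sC_mono_set Finset.sdiff_subset s ω hreach
    rcases hx with ⟨hxW, -⟩ | ⟨hxUZ, z, hzZ, hzo, hxz⟩
    · exact h x hxW hxU
    · refine h z (hZW hzZ) ?_
      obtain ⟨hsU, hx', hr⟩ := hxU
      exact ⟨hsU, ⟨hzo, hZU hzZ⟩, hr.trans (SimpleGraph.Adj.reachable (adj_iff.2
        ⟨hxz, ⟨hx'.1, hx'.2⟩, ⟨hzo, hZU hzZ⟩⟩))⟩
  · intro h x hxW hreach
    have hS : ∀ n ∈ sS Γ U Z ω, n ∉ sC Γ (U \ Z) s ω := fun n hn => h n (Or.inr hn)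
    obtain ⟨hxZ, hreach'⟩ := reach_restrict hs hS hreach
    exact h x (Or.inl ⟨hxW, hxZ⟩) hreach'

/-- On the event of `mem_sD_iff_restrict` the cluster of `s` in `U` is its cluster in `U ∖ Z`.
[cite: VandenbergHaggstromKahn2005, §1 p. 4, identity (6) and the remark following it] -/
theorem sC_restrict {U Z : Finset V} {s : V} (hs : s ∉ Z) {ω : Set V}
    (hS : ∀ n ∈ sS Γ U Z ω, n ∉ sC Γ (U \ Z) s ω) : sC Γ U s ω = sC Γ (U \ Z) s ω :=
  Set.Subset.antisymm (fun _ hv => (reach_restrict hs hS hv).2) (sC_mono_set Finset.sdiff_subset s ω)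

/-! ### Conditioning on the states of `Z` (site (6), summed) -/

variable [Fintype V]

variable (Γ) in
/-- The block expectation `T ↦ E[H(C_s^{U'}) · 1{s ↮ B ∪ T in U'}]` (site).
[cite: VandenbergHaggstromKahn2005, §1 p. 4 (`Pr(· | S)`)] -/
def blockE (q : V → ℝ) (U' : Finset V) (s : V) (H : Set V → ℝ) (B T : Set V) : ℝ :=
  ∑ ω, weight q ω * (H (sC Γ U' s ω) * ind (sD Γ U' s (B ∪ T)) ω)

/-- Block expectations of nonnegative functions are nonnegative. [folklore] -/
theorem blockE_nonneg {q : V → ℝ} (hq0 : ∀ v, 0 ≤ q v) (hq1 : ∀ v, q v ≤ 1) (U' : Finset V) (s : V)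
    {H : Set V → ℝ} (hH : ∀ a, 0 ≤ H a) (B T : Set V) : 0 ≤ blockE Γ q U' s H B T :=
  sum_ind_nonneg hq0 hq1 (fun _ => hH _) _

/-- **Site (6), summed**: `E[H(C_s^U) 1{s ↮ W in U}] = Σ_ω weight(ω) · E'[H(C_s^{U∖Z}) 1{s ↮ (W∖Z) ∪ S(ω)}]`
for `Z ⊆ W`, `s ∉ Z` — conditioning on the states of the vertices of `Z`.
[cite: VandenbergHaggstromKahn2005, §1 p. 4, the display before (5) and identity (6)] -/
theorem step_sum {U Z : Finset V} (hZU : Z ⊆ U) {s : V} (hs : s ∉ Z) {W : Set V}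
    (hZW : (↑Z : Set V) ⊆ W) (q : V → ℝ) (hm : ∑ ω, weight q ω = 1) (H : Set V → ℝ) :
    ∑ ω, weight q ω * (H (sC Γ U s ω) * ind (sD Γ U s W) ω) =
      ∑ ω, weight q ω * blockE Γ q (U \ Z) s H (W \ ↑Z) (sS Γ U Z ω) := by
  set A : Set V := ↑Z with hA
  set Φ : Set V → Set V → ℝ := fun ζ η =>
    H (sC Γ (U \ Z) s η) * ind (sD Γ (U \ Z) s ((W \ ↑Z) ∪ sS Γ U Z ζ)) η with hΦ
  have h1 : ∀ ω, H (sC Γ U s ω) * ind (sD Γ U s W) ω = Φ (ω ∩ A) (ω \ A) := by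
    intro ω
    simp only [hΦ, hA, sS_inter, sC_diff]
    by_cases hω : ω ∈ sD Γ U s W
    · have hω' := (mem_sD_iff_restrict hZU hs hZW ω).1 hω
      rw [ind_of_mem hω, ind_of_mem ((mem_sD_diff U Z s _ ω).2 hω'),
        sC_restrict hs fun n hn => hω' n (Or.inr hn)]
    · have hω' : ω \ ↑Z ∉ sD Γ (U \ Z) s ((W \ ↑Z) ∪ sS Γ U Z ω) := fun h =>
        hω ((mem_sD_iff_restrict hZU hs hZW ω).2 ((mem_sD_diff U Z s _ ω).1 h))
      rw [ind_of_not_mem hω, ind_of_not_mem hω', mul_zero, mul_zero]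
  have h2 : ∀ ω ω', Φ (ω ∩ A) (ω' \ A) =
      H (sC Γ (U \ Z) s ω') * ind (sD Γ (U \ Z) s ((W \ ↑Z) ∪ sS Γ U Z ω)) ω' := by
    intro ω ω'
    simp only [hΦ, hA, sS_inter, sC_diff]
    by_cases hω' : ω' ∈ sD Γ (U \ Z) s ((W \ ↑Z) ∪ sS Γ U Z ω)
    · rw [ind_of_mem hω', ind_of_mem ((mem_sD_diff U Z s _ ω').2 hω')]
    · rw [ind_of_not_mem hω', ind_of_not_mem (fun h => hω' ((mem_sD_diff U Z s _ ω').1 h))]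
  calc ∑ ω, weight q ω * (H (sC Γ U s ω) * ind (sD Γ U s W) ω)
      = (∑ ω, weight q ω) * ∑ ω, weight q ω * Φ (ω ∩ A) (ω \ A) := by
        rw [hm, one_mul]; simp_rw [h1]
    _ = ∑ ω, weight q ω * ∑ ω', weight q ω' * Φ (ω ∩ A) (ω' \ A) := blockFubini q A Φ
    _ = ∑ ω, weight q ω * blockE Γ q (U \ Z) s H (W \ ↑Z) (sS Γ U Z ω) := by
        simp_rw [h2]; rfl

end SiteBHK

end Summit.CriticalPhenomena.PercolationContinuityZ3.Theorems.Transplant
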